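import Summits.AtomisticToContinuum.HydrodynamicLimit.Theorems.CollisionIsometryCLTDiffuseBackwardInfluenceOnePathPotentials

/-!
# `DiffuseBackwardInfluence`, line `share-nondegeneracy-one-flight`, stub `stub_onePathBound` (4/5): scores and slots

Support file (`--supports stmt-AtomisticToContinuum-12950`). The counter bookkeeping of the one-path bound: the first
moment of the counter is the accumulated scoring mass (`first_moment`); every good (late slot, particle) pair scores,
at the particle's first collision of the slot (`sum_Gr_le`); and a tracer scores AT MOST ONCE PER LATE SLOT — after its
host's first collision of a slot it always sits on a host that has already collided in that slot — so the counter never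
exceeds the number `2m` of late slots (`support_bound`, registered sub-goal `onePath_support_bound`).
-/

namespace Summit.AtomisticToContinuum.HydrodynamicLimit.Theorems.DiffuseBackwardInfluenceShare

open scoped BigOperators Topology ENNReal InnerProductSpace Classical
open Filter Set MeasureTheory
open Literature.Analysis.FluidPDE
open Literature.MathematicalPhysics.KineticTheory (localGibbsLaw hsDiameter)
open Summit.AtomisticToContinuum.HydrodynamicLimit.Theorems.DiffuseBackwardInfluenceNeg

noncomputable section

namespace OnePath

section Potentials

variable {N : ℕ} {C : Src N}

/-! ### Scores: bookkeeping of the first moment of the counter -/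

/-- What `cfirst` is when the particle does collide in the slot. [folklore] -/
theorem cfirst_spec {r : ℕ} {i : Fin (N + 1)} (h : HasCollIn C.σ N C.y C.Δ (2 * C.m * C.L) r i) :
    cfirst C r i = Nat.find h ∧ nS C r ≤ cfirst C r i ∧ cfirst C r i < nS C (r + 1) ∧
      Touches C.σ N C.y (cfirst C r i) i := by
  have hc : cfirst C r i = Nat.find h := by unfold cfirst; rw [dif_pos h]
  refine ⟨hc, ?_⟩
  rw [hc]
  exact Nat.find_spec h

/-- No step of the slot before `cfirst` touches the particle. [folklore] -/
theorem not_touches_of_lt_cfirst {r : ℕ} {i : Fin (N + 1)} (h : HasCollIn C.σ N C.y C.Δ (2 * C.m * C.L) r i)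
    {c : ℕ} (h1 : nS C r ≤ c) (h2 : c < cfirst C r i) : ¬ Touches C.σ N C.y c i := by
  have hc : cfirst C r i = Nat.find h := (cfirst_spec h).1
  rw [hc] at h2
  have hmin := Nat.find_min h h2
  intro ht
  exact hmin ⟨h1, lt_trans (hc ▸ h2 :) (cfirst_spec h).2.2.1, ht⟩

/-- A scoring particle is touched by the scoring step. [folklore] -/
theorem touches_of_scores {c : ℕ} {i : Fin (N + 1)} (hs : Scores C c i) : Touches C.σ N C.y c i := by
  obtain ⟨r, _, ⟨h, _⟩, hc⟩ := hs
  rw [← hc]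
  exact (cfirst_spec h).2.2.2

variable (C) in
/-- The scoring mass of step `c`: `Σ_i [i scores at c] μ^c(i)`. -/
def inc (c : ℕ) : ℝ := ∑ i, if Scores C c i then mu C c i else 0

/-- FIRST MOMENT: `Σ_{i,j} φ_t(i,j) · j` is the scoring mass accumulated since the restart. [folklore] -/
theorem first_moment (K : ℕ) : ∀ t, t ≤ K →
    ∑ i, ∑ j ∈ Finset.range (K + 1), pot C 1 t i j * (j : ℝ) = ∑ c ∈ Finset.Ico (n0 C) (n0 C + t), inc C c := by
  intro t
  induction t with
  | zero =>
    intro _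
    simp only [pot, pow_one, add_zero, Finset.Ico_self, Finset.sum_empty]
    refine Finset.sum_eq_zero fun i _ => Finset.sum_eq_zero fun j _ => ?_
    split_ifs with hj
    · rw [hj]; simp
    · simp
  | succ t ih =>
    intro ht
    have ih' := ih (by omega)
    have hK : ∀ i', pot C 1 t i' K = 0 := fun i' => pot_eq_zero_of_lt 1 t i' K (by omega)
    rw [← add_assoc, Finset.sum_Ico_succ_top (Nat.le_add_right _ _), ← ih']
    by_cases h : (pairsAt C.σ N C.y (n0 C + t)).Nonempty
    · have hpq := some_fst_ne_some_snd h
      set p := h.some.1 with hp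
      set q := h.some.2 with hq
      set F : Fin (N + 1) → ℝ := fun i => ∑ j ∈ Finset.range (K + 1), pot C 1 t i j * (j : ℝ) with hF
      set F' : Fin (N + 1) → ℝ := fun i => ∑ j ∈ Finset.range (K + 1), pot C 1 (t + 1) i j * (j : ℝ) with hF'
      have hFi : ∀ i, i ≠ p → i ≠ q → F' i = F i := fun i hip hiq => by
        simp only [hF', hF, pot_succ_of h]
        exact Finset.sum_congr rfl fun j _ => by rw [transport_of_ne hip hiq]
      have hpq' : F' p + F' q = F p + F q +
          (if Scores C (n0 C + t) p then mu C (n0 C + t) p else 0) +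
          (if Scores C (n0 C + t) q then mu C (n0 C + t) q else 0) := by
        simp only [hF', hF, pot_succ_of h, ← sum_pot_one (C := C) K t (by omega)]
        exact sum_transport_mul_fst_add_snd hpq _ _ _ K hK
      have hinc : inc C (n0 C + t) = (if Scores C (n0 C + t) p then mu C (n0 C + t) p else 0) +
          (if Scores C (n0 C + t) q then mu C (n0 C + t) q else 0) := by
        unfold inc
        rw [sum_twoPoint hpq (fun _ => (0 : ℝ)) (fun i => if Scores C (n0 C + t) i then mu C (n0 C + t) i else 0)
          (if Scores C (n0 C + t) p then mu C (n0 C + t) p else 0)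
          (if Scores C (n0 C + t) q then mu C (n0 C + t) q else 0) ?_]
        · simp
        · intro i
          by_cases hip : i = p
          · rw [if_pos hip, hip]
          by_cases hiq : i = q
          · rw [if_neg hip, if_pos hiq, hiq]
          rw [if_neg hip, if_neg hiq, if_neg]
          intro hs
          obtain ⟨h', hor⟩ := touches_of_scores hs
          rcases hor with h1 | h2
          · exact hip h1.symm
          · exact hiq h2.symm
      show ∑ i, F' i = ∑ i, F i + inc C (n0 C + t)
      rw [sum_twoPoint hpq F F' (F' p) (F' q) ?_, hinc]
      · linarith [hpq']
      · intro i
        by_cases hip : i = p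
        · rw [if_pos hip, hip]
        by_cases hiq : i = q
        · rw [if_neg hip, if_pos hiq, hiq]
        rw [if_neg hip, if_neg hiq, hFi i hip hiq]
    · have hinc : inc C (n0 C + t) = 0 := by
        unfold inc
        refine Finset.sum_eq_zero fun i _ => ?_
        rw [if_neg]
        intro hs
        obtain ⟨h', _⟩ := touches_of_scores hs
        exact h h'
      simp only [pot_succ_of_not h, hinc, add_zero]

/-! ### Every good (late slot, particle) scores: `Σ_r G_r ≤` accumulated scoring mass -/

variable (C) in
/-- The late slots as a finset. -/
def lateSet : Finset ℕ := Finset.Ico (2 * C.m * C.L - 2 * C.m) (2 * C.m * C.L)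

variable (C) in
/-- The good mass of slot `r`: `G_r = Σ_i [good_r(i)] μ^{c_i}(i)`, masses read at the first collision `c_i`. -/
def Gr (r : ℕ) : ℝ := ∑ i, if Good C r i then mu C (cfirst C r i) i else 0

/-- Membership in `lateSet`. [folklore] -/
theorem mem_lateSet {r : ℕ} : r ∈ lateSet C ↔ Late C r := by
  unfold lateSet Late
  rw [Finset.mem_Ico]

/-- `#lateSet = 2m`. [folklore] -/
theorem card_lateSet (hL : 1 ≤ C.L) : (lateSet C).card = 2 * C.m := by
  unfold lateSet
  rw [Nat.card_Ico]
  have : 2 * C.m ≤ 2 * C.m * C.L := Nat.le_mul_of_pos_right _ hL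
  omega

/-- The first collision of a late slot is a late step: `n₀ ≤ c_i^r < fin`. [folklore] -/
theorem cfirst_mem_Ico (hΔ : 0 < C.Δ) (hpos : 0 < fin C) {r : ℕ} (hr : Late C r) {i : Fin (N + 1)}
    (h : HasCollIn C.σ N C.y C.Δ (2 * C.m * C.L) r i) : cfirst C r i ∈ Finset.Ico (n0 C) (fin C) := by
  obtain ⟨_, h1, h2, _⟩ := cfirst_spec h
  have hS : 0 < 2 * C.m * C.L := lt_of_le_of_lt (Nat.zero_le _) hr.2
  rw [Finset.mem_Ico]
  constructor
  · exact le_trans (slotStart_mono hΔ hpos hS hr.1 hr.2.le) h1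
  · have := slotStart_mono (σ := C.σ) (y := C.y) hΔ hpos hS (Nat.succ_le_of_lt hr.2) le_rfl
    unfold fin
    rw [← slotStart_self (σ := C.σ) (y := C.y) (Δ := C.Δ) hS]
    exact lt_of_lt_of_le h2 this

/-- EVERY GOOD PAIR SCORES ONCE: the good masses of the late slots are dominated by the accumulated scoring mass
(distinct late slots of the same particle score at distinct steps). [folklore] -/
theorem sum_Gr_le (hΔ : 0 < C.Δ) (hpos : 0 < fin C) :
    ∑ r ∈ lateSet C, Gr C r ≤ ∑ c ∈ Finset.Ico (n0 C) (fin C), inc C c := by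
  unfold Gr inc
  rw [Finset.sum_comm, Finset.sum_comm (s := Finset.Ico (n0 C) (fin C))]
  refine Finset.sum_le_sum fun i _ => ?_
  rw [← Finset.sum_filter, ← Finset.sum_filter]
  have hinj : Set.InjOn (fun r => cfirst C r i) ↑((lateSet C).filter fun r => Good C r i) := by
    intro r1 hr1 r2 hr2 heq
    simp only [Finset.coe_filter, Set.mem_setOf_eq, mem_lateSet] at hr1 hr2
    obtain ⟨h1, _⟩ := hr1.2
    obtain ⟨h2, _⟩ := hr2.2
    obtain ⟨_, a1, b1, _⟩ := cfirst_spec h1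
    obtain ⟨_, a2, b2, _⟩ := cfirst_spec h2
    simp only at heq
    rw [heq] at a1 b1
    exact slot_unique hΔ hpos hr1.1.2 hr2.1.2 a1 b1 a2 b2
  have himg : ∑ r ∈ (lateSet C).filter (fun r => Good C r i), mu C (cfirst C r i) i =
      ∑ c ∈ ((lateSet C).filter (fun r => Good C r i)).image (fun r => cfirst C r i), mu C c i :=
    (Finset.sum_image (f := fun c => mu C c i) hinj).symm
  rw [himg]
  refine Finset.sum_le_sum_of_subset_of_nonneg ?_ fun c _ _ => mu_nonneg c i
  intro c hc
  rw [Finset.mem_image] at hc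
  obtain ⟨r, hr, hrc⟩ := hc
  rw [Finset.mem_filter, mem_lateSet] at hr
  rw [Finset.mem_filter]
  obtain ⟨h1, _⟩ := hr.2
  rw [← hrc]
  exact ⟨cfirst_mem_Ico hΔ hpos hr.1 h1, r, hr.1, hr.2, rfl⟩

/-! ### At most one score per late slot: the counter never exceeds `2m` -/

variable (C) in
/-- The late slots started by step `n`. -/
def started (n : ℕ) : Finset ℕ := (lateSet C).filter fun r => nS C r ≤ n

variable (C) in
/-- The number of late slots started by step `n`. -/
def rho (n : ℕ) : ℕ := (started C n).card

variable (C) in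
/-- The last late slot start `≤ n` (junk `0` if none). -/
def lastStart (n : ℕ) : ℕ := (started C n).sup (nS C)

variable (C) in
/-- The particles that are FRESH at step `n` (an event, as a set): untouched since the last slot start. -/
def Fresh (n : ℕ) : Set (Fin (N + 1)) := fun i => ∀ c, lastStart C n ≤ c → c < n → ¬ Touches C.σ N C.y c i

/-- `lastStart n ≤ n`. [folklore] -/
theorem lastStart_le (n : ℕ) : lastStart C n ≤ n :=
  Finset.sup_le fun _ hr => (Finset.mem_filter.1 hr).2

/-- A scoring particle is fresh (its scoring step is its first collision of the current slot). [folklore] -/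
theorem fresh_of_scores {n : ℕ} {i : Fin (N + 1)} (hs : Scores C n i) : Fresh C n i := by
  obtain ⟨r, hr, ⟨h, _⟩, hc⟩ := hs
  intro c hc1 hc2
  have hmem : r ∈ started C n := by
    unfold started
    rw [Finset.mem_filter, mem_lateSet]
    exact ⟨hr, hc ▸ (cfirst_spec h).2.1⟩
  have hle : nS C r ≤ lastStart C n := Finset.le_sup (f := nS C) hmem
  exact not_touches_of_lt_cfirst h (le_trans hle hc1) (hc ▸ hc2)

/-- The slot bookkeeping from `n` to `n + 1`: either a late slot starts at `n + 1` (one more started slot), or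
nothing changes. [folklore] -/
theorem started_succ (n : ℕ) :
    (rho C n + 1 ≤ rho C (n + 1)) ∨ (rho C (n + 1) = rho C n ∧ lastStart C (n + 1) = lastStart C n) := by
  by_cases hnew : ∃ r ∈ lateSet C, nS C r = n + 1
  · left
    obtain ⟨r, hr, hrn⟩ := hnew
    unfold rho
    have hsub : started C n ⊆ started C (n + 1) := fun r' hr' => by
      unfold started at *
      rw [Finset.mem_filter] at *
      exact ⟨hr'.1, Nat.le_succ_of_le hr'.2⟩
    have hnot : r ∉ started C n := fun hmem => by
      unfold started at hmem
      rw [Finset.mem_filter] at hmem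
      omega
    have hmem : r ∈ started C (n + 1) := by
      unfold started
      rw [Finset.mem_filter]
      exact ⟨hr, hrn.le⟩
    calc (started C n).card + 1 = (insert r (started C n)).card := (Finset.card_insert_of_notMem hnot).symm
      _ ≤ (started C (n + 1)).card := Finset.card_le_card (Finset.insert_subset hmem hsub)
  · right
    have heq : started C (n + 1) = started C n := by
      unfold started
      ext r
      simp only [Finset.mem_filter]
      constructor
      · rintro ⟨hr, hle⟩
        refine ⟨hr, ?_⟩
        rcases Nat.lt_or_eq_of_le hle with hlt | heq
        · exact Nat.lt_succ_iff.1 hlt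
        · exact absurd ⟨r, hr, heq⟩ hnew
      · rintro ⟨hr, hle⟩
        exact ⟨hr, Nat.le_succ_of_le hle⟩
    unfold rho lastStart
    rw [heq]
    exact ⟨rfl, rfl⟩

/-- SUPPORT BOUND: mass with counter `j` at a fresh particle has `j + 1 ≤ #started late slots`, and `j ≤ #started
late slots` in any case (a tracer scores at most once per slot: after its host's first collision of the slot it
always sits on a host that has already collided in the slot). [folklore] -/
theorem support_bound (hm : 1 ≤ C.m) (hL : 1 ≤ C.L) : ∀ t i j, pot C 1 t i j ≠ 0 →
    j + (if Fresh C (n0 C + t) i then 1 else 0) ≤ rho C (n0 C + t) := by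
  intro t
  induction t with
  | zero =>
    intro i j hne
    simp only [pot, pow_one] at hne
    have hj : j = 0 := by
      by_contra hj
      exact hne (if_neg hj)
    subst hj
    have hmem : 2 * C.m * C.L - 2 * C.m ∈ started C (n0 C) := by
      unfold started
      rw [Finset.mem_filter, mem_lateSet]
      refine ⟨⟨le_rfl, ?_⟩, le_rfl⟩
      have h1 : 0 < 2 * C.m := by omega
      have h2 : 0 < 2 * C.m * C.L := Nat.mul_pos h1 (by omega)
      omega
    have h1 : 1 ≤ rho C (n0 C) := Finset.card_pos.2 ⟨_, hmem⟩
    simp only [add_zero, zero_add]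
    split_ifs <;> omega
  | succ t ih =>
    intro i j hne
    set n := n0 C + t with hn
    have hn1 : n0 C + (t + 1) = n + 1 := by rw [hn]; ring
    rw [hn1]
    -- (a) the counter bound at n, and untouched particles keep their potential
    have key : j ≤ rho C n ∧ (¬ Touches C.σ N C.y n i → pot C 1 t i j ≠ 0) := by
      by_cases h : (pairsAt C.σ N C.y n).Nonempty
      · rw [pot_succ_of h] at hne
        have hpq := some_fst_ne_some_snd h
        have hbump : ∀ p', bump (Scores C n p') (pot C 1 t p') j ≠ 0 → j ≤ rho C n := by
          intro p' hb
          rcases of_bump_ne_zero hb with ⟨hs, hj1, hne'⟩ | ⟨_, hne'⟩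
          · have := ih p' (j - 1) hne'
            rw [if_pos (fresh_of_scores hs)] at this
            omega
          · have := ih p' j hne'
            omega
        have htouch : ∀ p', (h.some.1 = p' ∨ h.some.2 = p') → Touches C.σ N C.y n p' := fun p' hp' => ⟨h, hp'⟩
        by_cases hip : i = h.some.1
        · rw [hip, transport_fst] at hne
          refine ⟨?_, fun hnt => absurd (htouch i (Or.inl hip.symm)) hnt⟩
          by_cases hb1 : bump (Scores C n h.some.1) (pot C 1 t h.some.1) j = 0
          · rw [hb1, mul_zero, zero_add] at hne
            exact hbump _ (right_ne_zero_of_mul hne)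
          · exact hbump _ hb1
        by_cases hiq : i = h.some.2
        · rw [hiq, transport_snd hpq] at hne
          refine ⟨?_, fun hnt => absurd (htouch i (Or.inr hiq.symm)) hnt⟩
          by_cases hb1 : bump (Scores C n h.some.2) (pot C 1 t h.some.2) j = 0
          · rw [hb1, mul_zero, zero_add] at hne
            exact hbump _ (right_ne_zero_of_mul hne)
          · exact hbump _ hb1
        rw [transport_of_ne hip hiq] at hne
        have := ih i j hne
        exact ⟨by omega, fun _ => hne⟩
      · rw [pot_succ_of_not h] at hne
        have := ih i j hne
        exact ⟨by omega, fun _ => hne⟩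
    rcases started_succ (C := C) n with hgrow | ⟨hrho, hlast⟩
    · have : (if Fresh C (n + 1) i then 1 else 0) ≤ 1 := by split_ifs <;> omega
      omega
    · rw [hrho]
      by_cases ht : Touches C.σ N C.y n i
      · have hnf : ¬ Fresh C (n + 1) i := fun hf =>
          hf n (hlast ▸ lastStart_le (C := C) n) (Nat.lt_succ_self n) ht
        rw [if_neg hnf]
        omega
      · have hne' := key.2 ht
        have hiff : Fresh C (n + 1) i ↔ Fresh C n i := by
          unfold Fresh
          rw [hlast]
          constructor
          · intro hf c hc1 hc2
            exact hf c hc1 (Nat.lt_succ_of_lt hc2)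
          · intro hf c hc1 hc2
            rcases Nat.lt_or_eq_of_le (Nat.lt_succ_iff.1 hc2) with hlt | heq
            · exact hf c hc1 hlt
            · rw [heq]; exact ht
        have := ih i j hne'
        by_cases hf : Fresh C n i
        · rw [if_pos (hiff.2 hf)]; rw [if_pos hf] at this; exact this
        · rw [if_neg (fun h' => hf (hiff.1 h'))]; rw [if_neg hf] at this; exact this

/-- The counter never exceeds `2m`. [folklore] -/
theorem le_two_mul_of_pot_ne_zero (hm : 1 ≤ C.m) (hL : 1 ≤ C.L) {t : ℕ} {i : Fin (N + 1)} {j : ℕ}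
    (hne : pot C 1 t i j ≠ 0) : j ≤ 2 * C.m := by
  have h1 := support_bound hm hL t i j hne
  have h2 : rho C (n0 C + t) ≤ 2 * C.m := by
    unfold rho started
    rw [← card_lateSet (C := C) hL]
    exact Finset.card_filter_le _ _
  have : (if Fresh C (n0 C + t) i then 1 else 0) ≥ 0 := Nat.zero_le _
  omega

end Potentials

end OnePath

/-- AT MOST ONE SCORE PER LATE SLOT (registered sub-goal): the score counter of the single potential never exceeds
`2m`. [folklore] -/
theorem onePath_support_bound : ∀ (N : ℕ) (C : OnePath.Src N), 1 ≤ C.m → 1 ≤ C.L → ∀ (t : ℕ) (i : Fin (N + 1)) (j : ℕ), OnePath.pot C 1 t i j ≠ 0 → j ≤ 2 * C.m :=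
  fun _ _ hm hL _ _ _ hne => OnePath.le_two_mul_of_pot_ne_zero hm hL hne

end

end Summit.AtomisticToContinuum.HydrodynamicLimit.Theorems.DiffuseBackwardInfluenceShare
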